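import Mathlib
import Summits.KontsevichZagierPeriods.Zeta5Search.TopFamilyFPCellsI
import Summits.KontsevichZagierPeriods.Zeta5Search.TopFamilyFPCellsJ
import Summits.KontsevichZagierPeriods.Zeta5Search.DenomLaw.TopFamilyFPPath
import Summits.KontsevichZagierPeriods.Zeta5Search.LawA4Proof
import HarnessLib

/-!
# ζ(5) search — PATH ACCOUNTING on the DEEP first-period cells of the TOP linear family (THEOREM L5 / A⁗′ in ONE frame), hence on the WHOLE first period for every `t ≥ 10`

Cell `pub-zeta5` (HONEST FRAMING: systematic search; no irrationality claim unless certified), TRACK «DENOM-LAW» D1 prover seat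
(denom-prover-d1 g16, `HOME/denom-law/prover-d1/ATTEMPT-16.md` §4).  Continuation of `DenomLaw/TopFamilyFPPath` (the node
`DenomLaw.PathAccountingFirstPeriod` — Brown–Zudilin (28)+(30) transported, Casoratian form — on the TOP linear family `bTop t n = bLin (t n + 2n) (t n) n
= n·(3t+16; t+8, …, t+2)` above the innermost block).  Here the DEEP first-period cells `(t+11)n < 2p`, `p ≤ (t+1)n` (all seven parameters and all
21 pair blocks reach `p`; `N_p = 21`, `C⋆ = 11`, `⌊d/p⌋ ∈ {3, 2}`; PATH value `−12` / `−13` = `casLB + 5` / `casLB + 4`) are proved for every `t ≥ 10`,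
every `n ≥ 1` and every direction `j` — by the tree's SECOND-ORDER rungs in ONE FRAME `(M, T) = (10, [1,−6,−6,1])`: on every deep cell the multipole
classes of least exponent are the centre-free palindrome `[1,−6,−6,1]` (exponent `−10`) and the classes at `ν = −9, −8, −7` are its single raises,
admissible double raises and degree-3 raises (the machine-generated covers `TopFamilyFPCellsI/J` and the type-level check `DenomLaw.checkL5` of gen 3's
`ShiftedL5Kit`, both parities of `tn`), so
* on `3p ≤ (2t+13)n = d` (`⌊d/p⌋ = 3`; the degree condition `6p ≤ 2d + 1` holds) THEOREM L5 (`SecondOrder.lawA5_holds` via `DenomLaw.cover_L5`) gives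
  `v ≥ 8 − 2M = −12` (`cas_ge_d3`, `t ≥ 8`), and
* on `3p > (2t+13)n`, `p ≤ (t+1)n` (`⌊d/p⌋ = 2`) THEOREM A⁗′ (`SecondOrder.lawA4_holds` via `DenomLaw.clausesL5_of_cover` + `RecordWindowsA4.lawA4_apply`)
  gives `v ≥ 7 − 2M = −13` (`cas_ge_d2`, `t ≥ 10`; contains gen 3's conjugate-raise cell `tn < p ≤ (t+1)n` of `DenomLaw/TopFamilyCRCellCR`, re-proved in the
  palindromic frame).
Then §3: `pathAccounting_tf_deep`, **`pathAccounting_tf_firstPeriod` (every first-period prime, every `j`, all `t ≥ 10`, all `n`)** and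
**`pathAccountingFirstPeriod_on_tf_ge10` — the node with `b := bTop t n`, binders VERBATIM, for every `t ≥ 10` and every `n ≥ 1`**; with
`TopFamFP.pathAccountingFirstPeriod_on_tf` (`4 ≤ t ≤ 7`) the node holds on the whole first period of the TOP family for every `t ≥ 4` except `t = 8, 9`,
where the sliver `(t+1)n < p ≤ (2t+13)n/3` (`N_p = 20`, `⌊d/p⌋ = 3`, node value `−11`; L5 gives `−12`) remains OPEN (`pathAccountingFirstPeriod_tf_le9`).
So Brown–Zudilin's prime-by-prime accounting is a theorem, for all `n`, on the infinite family of directions `(7,13,9,12,11,15,17,12) + (t−6)·(1,…,1)`,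
`t ≥ 10` (and `t = 4,…,7`).  MODEL/structure-side valuation bookkeeping of the cell's own rationals; nothing about ζ(5); no γ; records in print UNMOVED.
-/

open Finset

namespace Summit.KontsevichZagierPeriods.Zeta5Search.TopFamFP

open Summit.KontsevichZagierPeriods.Zeta5Search.ClusterValuation
open Summit.KontsevichZagierPeriods.Zeta5Search.CasoratianValuation (InPolytope shift casoratian pairFloors refund)
open Summit.KontsevichZagierPeriods.Zeta5Search.WedgeDictionary (dOf)
open Summit.KontsevichZagierPeriods.Zeta5Search.ClassTypeCover
open Summit.KontsevichZagierPeriods.Zeta5Search.CellKit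
open Summit.KontsevichZagierPeriods.Zeta5Search.TopFamCR (tf_zero dOf_tf inPolytope_tf)
open Summit.KontsevichZagierPeriods.Zeta5Search.StaircaseCells (bTop)
open Summit.KontsevichZagierPeriods.Zeta5Search.DenomLaw (cStar FirstPeriod Sorted7 checkL5 cover_L5 clausesL5_of_cover)
open Summit.KontsevichZagierPeriods.Zeta5Search.DenomLaw.FirstPeriodKit (cStar_le_eleven)
open Summit.KontsevichZagierPeriods.Zeta5Search.RecordWindowsA4 (lawA4_apply)
open Summit.KontsevichZagierPeriods.Zeta5Search.SecondOrder (lawA4_holds)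
open Summit.KontsevichZagierPeriods.Zeta5Search.StairTS3 (refund_le_pathHead)

/-! ## §1 The integer data on the deep cells -/

section Arith
variable {t n p : ℕ}

/-- `⌊d/p⌋ = 3` for `(2t+13)n < 4p`, `3p ≤ (2t+13)n`. -/
theorem dOf_tf_div_three (h1 : 2 * (t * n) + 13 * n < 4 * p) (h2 : 3 * p ≤ 2 * (t * n) + 13 * n) :
    dOf (bLin (t * n + 2 * n) (t * n) n) / (p : ℤ) = 3 := by
  have hp0 : (0 : ℤ) < p := by exact_mod_cast (show 0 < p by omega)
  have h1' : ((2 * (t * n) + 13 * n : ℕ) : ℤ) < 4 * p := by exact_mod_cast h1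
  have h2' : (3 * p : ℤ) ≤ ((2 * (t * n) + 13 * n : ℕ) : ℤ) := by exact_mod_cast h2
  rw [dOf_tf]
  apply le_antisymm
  · have : (((2 * (t * n) + 13 * n : ℕ) : ℤ)) / (p : ℤ) < 4 := by rw [Int.ediv_lt_iff_lt_mul hp0]; linarith
    omega
  · rw [Int.le_ediv_iff_mul_le hp0]; linarith

/-- **`N_p = 21` on the deep cells**: for `p ≤ (t+1)n` and `(t+11)n < 2p` every one of the 21 pair blocks `(t+i+k−2)·n` lies in `[p, 2p)`. -/
theorem pairFloors_deep (hB : p ≤ t * n + n) (hF : t * n + 11 * n < 2 * p) :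
    pairFloors (bLin (t * n + 2 * n) (t * n) n) p = 21 := by
  have hp0 : (0 : ℤ) < p := by exact_mod_cast (show 0 < p by omega)
  have hq : ∀ (a b : ℤ) (c : ℕ), (16 : ℤ) - a - b = c → 1 ≤ c → c ≤ 11 →
      (3 * ((t : ℤ) * n) + 16 * n - ((t : ℤ) * n + a * n) - ((t : ℤ) * n + b * n)) / (p : ℤ) = 1 := by
    intro a b c h hc1 hc11
    rw [show 3 * ((t : ℤ) * n) + 16 * n - ((t : ℤ) * n + a * n) - ((t : ℤ) * n + b * n) = ((t * n + c * n : ℕ) : ℤ) by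
      push_cast; rw [← h]; ring]
    have hlo : (p : ℤ) ≤ ((t * n + c * n : ℕ) : ℤ) := by
      have : t * n + 1 * n ≤ t * n + c * n := by gcongr
      exact_mod_cast (show p ≤ t * n + c * n by omega)
    have hhi : ((t * n + c * n : ℕ) : ℤ) < 2 * p := by
      have : t * n + c * n ≤ t * n + 11 * n := by gcongr
      exact_mod_cast (show t * n + c * n < 2 * p by omega)
    rw [Int.ediv_eq_iff_of_pos hp0]; constructor <;> linarith
  unfold pairFloors
  simp only [sum_range_succ, sum_range_zero, zero_add, Nat.reduceAdd, v0, v1, v2, v3, v4, v5, v6, v7, Nat.lt_irrefl, if_false,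
    show (0:ℕ) < 1 by norm_num, show (0:ℕ) < 2 by norm_num, show (0:ℕ) < 3 by norm_num, show (0:ℕ) < 4 by norm_num, show (0:ℕ) < 5 by norm_num,
    show (0:ℕ) < 6 by norm_num, show (1:ℕ) < 2 by norm_num, show (1:ℕ) < 3 by norm_num, show (1:ℕ) < 4 by norm_num, show (1:ℕ) < 5 by norm_num,
    show (1:ℕ) < 6 by norm_num, show (2:ℕ) < 3 by norm_num, show (2:ℕ) < 4 by norm_num, show (2:ℕ) < 5 by norm_num, show (2:ℕ) < 6 by norm_num,
    show (3:ℕ) < 4 by norm_num, show (3:ℕ) < 5 by norm_num, show (3:ℕ) < 6 by norm_num, show (4:ℕ) < 5 by norm_num, show (4:ℕ) < 6 by norm_num,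
    show (5:ℕ) < 6 by norm_num, if_true,
    show ¬ (1:ℕ) < 0 by norm_num, show ¬ (2:ℕ) < 0 by norm_num, show ¬ (3:ℕ) < 0 by norm_num, show ¬ (4:ℕ) < 0 by norm_num, show ¬ (5:ℕ) < 0 by norm_num,
    show ¬ (6:ℕ) < 0 by norm_num, show ¬ (2:ℕ) < 1 by norm_num, show ¬ (3:ℕ) < 1 by norm_num, show ¬ (4:ℕ) < 1 by norm_num, show ¬ (5:ℕ) < 1 by norm_num,
    show ¬ (6:ℕ) < 1 by norm_num, show ¬ (3:ℕ) < 2 by norm_num, show ¬ (4:ℕ) < 2 by norm_num, show ¬ (5:ℕ) < 2 by norm_num, show ¬ (6:ℕ) < 2 by norm_num,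
    show ¬ (4:ℕ) < 3 by norm_num, show ¬ (5:ℕ) < 3 by norm_num, show ¬ (6:ℕ) < 3 by norm_num, show ¬ (5:ℕ) < 4 by norm_num, show ¬ (6:ℕ) < 4 by norm_num,
    show ¬ (6:ℕ) < 5 by norm_num, add_zero]
  rw [hq 8 7 1 (by norm_num) (by norm_num) (by norm_num), hq 8 6 2 (by norm_num) (by norm_num) (by norm_num),
      hq 8 5 3 (by norm_num) (by norm_num) (by norm_num), hq 8 4 4 (by norm_num) (by norm_num) (by norm_num),
      hq 8 3 5 (by norm_num) (by norm_num) (by norm_num), hq 8 2 6 (by norm_num) (by norm_num) (by norm_num),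
      hq 7 6 3 (by norm_num) (by norm_num) (by norm_num), hq 7 5 4 (by norm_num) (by norm_num) (by norm_num),
      hq 7 4 5 (by norm_num) (by norm_num) (by norm_num), hq 7 3 6 (by norm_num) (by norm_num) (by norm_num),
      hq 7 2 7 (by norm_num) (by norm_num) (by norm_num), hq 6 5 5 (by norm_num) (by norm_num) (by norm_num),
      hq 6 4 6 (by norm_num) (by norm_num) (by norm_num), hq 6 3 7 (by norm_num) (by norm_num) (by norm_num),
      hq 6 2 8 (by norm_num) (by norm_num) (by norm_num), hq 5 4 7 (by norm_num) (by norm_num) (by norm_num),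
      hq 5 3 8 (by norm_num) (by norm_num) (by norm_num), hq 5 2 9 (by norm_num) (by norm_num) (by norm_num),
      hq 4 3 9 (by norm_num) (by norm_num) (by norm_num), hq 4 2 10 (by norm_num) (by norm_num) (by norm_num),
      hq 3 2 11 (by norm_num) (by norm_num) (by norm_num)]
  norm_num

/-- Window facts on the deep range (`t ≥ 8`, `n ≥ 1`, `(t+11)n < 2p`): `5 ≤ p` and `b₀ + 2 < p²` (`p ≥ 10` and `2p ≥ (t+11)n + 1`). -/
theorem window_deep (ht : 8 * n ≤ t * n) (hn : 1 ≤ n) (hF : t * n + 11 * n < 2 * p) :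
    5 ≤ p ∧ (bLin (t * n + 2 * n) (t * n) n 0 + 2 : ℤ) < (p : ℤ) ^ 2 := by
  refine ⟨by omega, ?_⟩
  rw [tf_zero]
  have h1 : ((t * n + 11 * n + 1 : ℕ) : ℤ) ≤ 2 * p := by exact_mod_cast (show t * n + 11 * n + 1 ≤ 2 * p by omega)
  have h2 : (10 : ℤ) ≤ p := by exact_mod_cast (show 10 ≤ p by omega)
  have h3 : (10 : ℤ) * p ≤ (p : ℤ) * p := mul_le_mul_of_nonneg_right h2 (by positivity)
  push_cast at h1 ⊢
  have ht' : (8 : ℤ) * n ≤ t * n := by exact_mod_cast ht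
  nlinarith

end Arith

/-! ## §2 The two deep cells, any direction `j` -/

/-- **The `⌊d/p⌋ = 3` deep cell `(t+11)n < 2p`, `3p ≤ (2t+13)n`**, any `j`, all `t ≥ 8`, `n ≥ 1`: `v_p(Cas_j(bTop t n)) ≥ −12` by THEOREM L5 in the frame
`(10, [1,−6,−6,1])` (`DenomLaw.cover_L5`; the degree condition `6p ≤ 2d + 1` is `3p ≤ d`; parity-split covers `cover_d3_ev/od`). -/
theorem cas_ge_d3 {t n j p : ℕ} (ht : 8 * n ≤ t * n) (hn : 1 ≤ n) (hj1 : 1 ≤ j) (hj7 : j ≤ 7) (hprime : p.Prime)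
    (hA : t * n + 11 * n < 2 * p) (hB : 3 * p ≤ 2 * (t * n) + 13 * n)
    (hcas : casoratian (bLin (t * n + 2 * n) (t * n) n) j ≠ 0) :
    (-12 : ℤ) ≤ padicValRat p (casoratian (bLin (t * n + 2 * n) (t * n) n) j) := by
  haveI : Fact p.Prime := ⟨hprime⟩
  have hp2 : p % 2 = 1 := Nat.odd_iff.1 (hprime.odd_of_ne_two (by omega))
  obtain ⟨hp5, hwin⟩ := window_deep ht hn hA
  have hb := inPolytope_tf t n
  have hb' := inPolytope_shift_tf_j (show 4 * n ≤ t * n by omega) hn j hj1 hj7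
  have hpb : (p : ℤ) ≤ bLin (t * n + 2 * n) (t * n) n 0 := le_b0_tf (by omega)
  have hdeg : (p : ℤ) * ((10 : ℕ) - 4 : ℤ) ≤ 2 * dOf (bLin (t * n + 2 * n) (t * n) n) + 1 := by
    rw [dOf_tf]; push_cast
    have : (3 * p : ℤ) ≤ 2 * (t * n) + 13 * n := by exact_mod_cast hB
    linarith
  rcases Nat.mod_two_eq_zero_or_one (t * n) with hr | hr
  · exact cover_L5 hb hb' hj1 hj7 hprime hp5 hpb hwin (cover_d3_ev ht hn hA hB hp2 hr) (M := 10) (by norm_num) (by decide)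
      (T := [1, -6, -6, 1]) (by decide) (by rw [oddFlag_even hr]; exact checkL5_d3_ev) hdeg (by norm_num) hcas
  · have hno : n % 2 = 1 := Nat.odd_iff.mp (Nat.odd_mul.mp (Nat.odd_iff.mpr hr)).2
    exact cover_L5 hb hb' hj1 hj7 hprime hp5 hpb hwin (cover_d3_od ht hn hA hB hp2 hr hno) (M := 10) (by norm_num) (by decide)
      (T := [1, -6, -6, 1]) (by decide) (by rw [oddFlag_odd hr]; exact checkL5_d3_od) hdeg (by norm_num) hcas

/-- **The `⌊d/p⌋ = 2` deep cell `(2t+13)n < 3p`, `p ≤ (t+1)n`** (first period), any `j`, all `t ≥ 10`, `n ≥ 1`: `v_p(Cas_j(bTop t n)) ≥ −13` by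
THEOREM A⁗′ (`SecondOrder.lawA4_holds`) in the frame `(10, [1,−6,−6,1])` — the `LawA4Classes` clauses from the covers `cover_d2_ev/od` through
`DenomLaw.clausesL5_of_cover`. -/
theorem cas_ge_d2 {t n j p : ℕ} (ht : 10 * n ≤ t * n) (hn : 1 ≤ n) (hj1 : 1 ≤ j) (hj7 : j ≤ 7) (hprime : p.Prime)
    (hA : 2 * (t * n) + 13 * n < 3 * p) (hB : p ≤ t * n + n) (hF : t * n + 11 * n < 2 * p)
    (hcas : casoratian (bLin (t * n + 2 * n) (t * n) n) j ≠ 0) :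
    (-13 : ℤ) ≤ padicValRat p (casoratian (bLin (t * n + 2 * n) (t * n) n) j) := by
  haveI : Fact p.Prime := ⟨hprime⟩
  have hp2 : p % 2 = 1 := Nat.odd_iff.1 (hprime.odd_of_ne_two (by omega))
  obtain ⟨hp5, hwin⟩ := window_deep (show 8 * n ≤ t * n by omega) hn hF
  have hb := inPolytope_tf t n
  have hb' := inPolytope_shift_tf_j (show 4 * n ≤ t * n by omega) hn j hj1 hj7
  have hpb : (p : ℤ) ≤ bLin (t * n + 2 * n) (t * n) n 0 := le_b0_tf (by omega)
  have hT : ([1, -6, -6, 1] : List ℤ).reverse = [1, -6, -6, 1] := by decide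
  rcases Nat.mod_two_eq_zero_or_one (t * n) with hr | hr
  · obtain ⟨hC, -⟩ := clausesL5_of_cover (cover_d2_ev ht hn hA hB hF hp2 hr) (M := 10) (T := [1, -6, -6, 1])
      (by rw [oddFlag_even hr]; exact checkL5_d2_ev)
    have h := lawA4_apply lawA4_holds _ p j 10 [1, -6, -6, 1] hb hb' hj1 hj7 hprime hp5 hpb hwin (by norm_num) (by decide) hT hC hcas
    push_cast at h; linarith
  · have hno : n % 2 = 1 := Nat.odd_iff.mp (Nat.odd_mul.mp (Nat.odd_iff.mpr hr)).2
    obtain ⟨hC, -⟩ := clausesL5_of_cover (cover_d2_od ht hn hA hB hF hp2 hr hno) (M := 10) (T := [1, -6, -6, 1])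
      (by rw [oddFlag_odd hr]; exact checkL5_d2_od)
    have h := lawA4_apply lawA4_holds _ p j 10 [1, -6, -6, 1] hb hb' hj1 hj7 hprime hp5 hpb hwin (by norm_num) (by decide) hT hC hcas
    push_cast at h; linarith

/-! ## §3 The assembly: the deep range, the whole first period (`t ≥ 10`), the node verbatim -/

/-- **PATH accounting on the deep range `(t+11)n < 2p`, `p ≤ (t+1)n`**, every `j`, all `t ≥ 10`, `n ≥ 1`: `N_p = 21`, `C⋆ ≤ 11`, so the node asks
`⌊d/p⌋ − 15 ≤ v`, i.e. `−12` (L5) or `−13` (A⁗′). -/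
theorem pathAccounting_tf_deep (t n j p : ℕ) (ht : 10 ≤ t) (hn : 1 ≤ n) (hj1 : 1 ≤ j) (hj7 : j ≤ 7) (hprime : p.Prime)
    (hF : t * n + 11 * n < 2 * p) (hB : p ≤ t * n + n)
    (hcas : casoratian (bLin (t * n + 2 * n) (t * n) n) j ≠ 0) :
    dOf (bLin (t * n + 2 * n) (t * n) n) / (p : ℤ) - pairFloors (bLin (t * n + 2 * n) (t * n) n) p
        - min (if 2 ≤ dOf (bLin (t * n + 2 * n) (t * n) n) / (p : ℤ) then (1 : ℤ) else 0) (5 - (cStar (bLin (t * n + 2 * n) (t * n) n) p : ℤ))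
      ≤ padicValRat p (casoratian (bLin (t * n + 2 * n) (t * n) n) j) := by
  have htn : 10 * n ≤ t * n := Nat.mul_le_mul_right n ht
  have hC11 : (cStar (bLin (t * n + 2 * n) (t * n) n) p : ℤ) ≤ 11 := by exact_mod_cast cStar_le_eleven _ p
  have hmin : -6 ≤ min (1 : ℤ) (5 - (cStar (bLin (t * n + 2 * n) (t * n) n) p : ℤ)) := le_min (by norm_num) (by linarith)
  rw [pairFloors_deep hB hF]
  by_cases h3 : 3 * p ≤ 2 * (t * n) + 13 * n
  · rw [dOf_tf_div_three (by omega) h3, if_pos (by norm_num)]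
    linarith [cas_ge_d3 (show 8 * n ≤ t * n by omega) hn hj1 hj7 hprime hF h3 hcas]
  · push Not at h3
    rw [dOf_tf_div_two h3 (by omega), if_pos (le_refl _)]
    linarith [cas_ge_d2 htn hn hj1 hj7 hprime h3 hB hF hcas]

/-- **PATH accounting on the WHOLE FIRST PERIOD of the TOP family, every direction `j`, all `t ≥ 10`, all `n ≥ 1`**: for every prime `p` with
`(t+11)n < 2p` (the first period) and `Cas_j(bTop t n) ≠ 0`, the node's inequality holds. -/
theorem pathAccounting_tf_firstPeriod (t n j p : ℕ) (ht : 10 ≤ t) (hn : 1 ≤ n) (hj1 : 1 ≤ j) (hj7 : j ≤ 7) (hprime : p.Prime)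
    (hF : t * n + 11 * n < 2 * p) (hcas : casoratian (bLin (t * n + 2 * n) (t * n) n) j ≠ 0) :
    dOf (bLin (t * n + 2 * n) (t * n) n) / (p : ℤ) - pairFloors (bLin (t * n + 2 * n) (t * n) n) p
        - min (if 2 ≤ dOf (bLin (t * n + 2 * n) (t * n) n) / (p : ℤ) then (1 : ℤ) else 0) (5 - (cStar (bLin (t * n + 2 * n) (t * n) n) p : ℤ))
      ≤ padicValRat p (casoratian (bLin (t * n + 2 * n) (t * n) n) j) := by
  have htn : 10 * n ≤ t * n := Nat.mul_le_mul_right n ht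
  by_cases hB : p ≤ t * n + n
  · exact pathAccounting_tf_deep t n j p ht hn hj1 hj7 hprime hF hB hcas
  · push Not at hB
    exact pathAccounting_tf t n j p (by omega) hn hj1 hj7 hprime hB (by omega) hF hcas

/-- **The node `PathAccountingFirstPeriod` restricted to the TOP family `bTop t n`, EVERY `t ≥ 10`, literally** (all its binders, `b := bTop t n`),
all `n ≥ 1` — Brown–Zudilin's prime-by-prime accounting (28)+(30) on the whole first period of every direction
`(7,13,9,12,11,15,17,12) + (t−6)·(1,…,1)`, `t ≥ 10`, for all `n`. -/
theorem pathAccountingFirstPeriod_on_tf_ge10 (t : ℕ) (ht : 10 ≤ t) (n p : ℕ) (hn : 1 ≤ n) :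
    InPolytope (bTop t n) → Sorted7 (bTop t n) → InPolytope (shift (bTop t n) 7) → p.Prime → 5 ≤ p →
    (bTop t n 0 + 2 : ℤ) < (p : ℤ) ^ 2 → FirstPeriod (bTop t n) p → casoratian (bTop t n) 7 ≠ 0 →
      dOf (bTop t n) / (p : ℤ) - pairFloors (bTop t n) p
          - min (if 2 ≤ dOf (bTop t n) / (p : ℤ) then (1 : ℤ) else 0) (5 - (cStar (bTop t n) p : ℤ))
        ≤ padicValRat p (casoratian (bTop t n) 7) :=
  fun _ _ _ hprime _ _ hfp hcas =>
    pathAccounting_tf_firstPeriod t n 7 p ht hn (by norm_num) (by norm_num) hprime (fp_bound_of_firstPeriod hfp) hcas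

/-- **The node on the TOP family for every `t ≥ 4` outside `{8, 9}`**, binders verbatim (`4 ≤ t ≤ 7`: `TopFamFP.pathAccountingFirstPeriod_on_tf`;
`t ≥ 10`: the deep cells above). -/
theorem pathAccountingFirstPeriod_on_bTop (t : ℕ) (ht : 4 ≤ t) (h89 : t ≠ 8 ∧ t ≠ 9) (n p : ℕ) (hn : 1 ≤ n) :
    InPolytope (bTop t n) → Sorted7 (bTop t n) → InPolytope (shift (bTop t n) 7) → p.Prime → 5 ≤ p →
    (bTop t n 0 + 2 : ℤ) < (p : ℤ) ^ 2 → FirstPeriod (bTop t n) p → casoratian (bTop t n) 7 ≠ 0 →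
      dOf (bTop t n) / (p : ℤ) - pairFloors (bTop t n) p
          - min (if 2 ≤ dOf (bTop t n) / (p : ℤ) then (1 : ℤ) else 0) (5 - (cStar (bTop t n) p : ℤ))
        ≤ padicValRat p (casoratian (bTop t n) 7) := by
  by_cases h7 : t ≤ 7
  · exact pathAccountingFirstPeriod_on_tf t ht h7 n p hn
  · exact pathAccountingFirstPeriod_on_tf_ge10 t (by omega) n p hn

/-- **(CV) on the whole first-period TOP family, every direction `j`, all `t ≥ 10`, all `n`** (the (CV) value never exceeds the PATH value). -/
theorem tfRayCV_firstPeriod (t n j p : ℕ) (ht : 10 ≤ t) (hn : 1 ≤ n) (hj1 : 1 ≤ j) (hj7 : j ≤ 7) (hprime : p.Prime)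
    (hF : t * n + 11 * n < 2 * p) (hcas : casoratian (bLin (t * n + 2 * n) (t * n) n) j ≠ 0) :
    refund (bLin (t * n + 2 * n) (t * n) n) p - pairFloors (bLin (t * n + 2 * n) (t * n) n) p
      ≤ padicValRat p (casoratian (bLin (t * n + 2 * n) (t * n) n) j) := by
  linarith [refund_le_pathHead (bLin (t * n + 2 * n) (t * n) n) p (5 - (cStar (bLin (t * n + 2 * n) (t * n) n) p : ℤ)),
    pathAccounting_tf_firstPeriod t n j p ht hn hj1 hj7 hprime hF hcas]

end Summit.KontsevichZagierPeriods.Zeta5Search.TopFamFP
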